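import Literature.NumberTheory.Automorphic.JacquetLengthTwoLabelsEmb
import HarnessLib

/-!
# The labelled pair of a length-two `ρ ≅ i_P^G σ` from the embedding property — ABSTRACT `ρ`, unifiable binders

Generic representation theory (one theorem, no definition): the statement of ★ `IrrClass.labelledPair_exists_of_line_normalizedInd`
(`Automorphic/JacquetLengthTwoLabelsEmb`; [Casselman1995, Cor. 6.3.9 (b), §7.1]) for an ABSTRACT representation `ρ` given together with an equivalence
`eρ : ρ ≅ i_P^G σ` (and `eρ' : ρ' ≅ i_P^G σ'` for the second embedding target), all class binders IMPLICIT (fixed by unification from the first explicit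
argument, the line data `hfd`).  Purpose (cell pub/hodgecm-mathlib F0∕P3, T3 «KeysCaseTwo» stub S2): the caller's `ρ` is a `def` unfolding to `i_P^G σ`
(★ `cmPrincipalSeries`), the cited statements speak about that `def`, and `eρ := Equiv.refl _` confines the (slow, at the CM carrier) definitional unfolding
to ONE place instead of one per hypothesis.

## References
[Casselman1995] §3.2 (3.2.3, 3.2.4), §6.3 Cor. 6.3.9, §7.1 · [BernsteinZelevinsky1977] Prop. 1.9, Cor. 2.13 (c) · [BushnellHenniart2006] §2.
-/

set_option autoImplicit false

noncomputable section

open scoped MonoidAlgebra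
open Literature.RepresentationTheory.FiniteGroups Literature.RepresentationTheory.Semisimple

namespace Literature.NumberTheory.Automorphic

namespace IrrClass

/-- **THE LABELLED PAIR, abstract `ρ ≅ i_P^G σ`** (see the module docstring).  Output = the shape of stub S2:
`∃ πs πn, πs ≠ πn ∧ (constituents of ρ = {πn, πs}) ∧ (∃ r, ⟦r⟧ = πs ∧ r(r) ≅ θ₂) ∧ (∃ r, ⟦r⟧ = πn ∧ r(r) ≅ θ₁)`.
[cite: Casselman1995, L. 7.1.1 (a), Cor. 7.1.2, Cor. 6.3.9 (b), Prop. 6.4.1, Thm 3.2.4] [cite: BernsteinZelevinsky1977, Prop. 1.9, Cor. 2.13 (c)] -/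
theorem labelledPair_exists_of_line_abs {G : Type} {instG : Group G} {instT : TopologicalSpace G} {instTG : IsTopologicalGroup G}
    {t : ParabolicTriple G} {instLC : LocallyCompactSpace t.P}
    {V : Type} {instV₁ : AddCommGroup V} {instV₂ : Module ℂ V} {ρ : Representation ℂ G V} {θ₁ θ₂ : ↥t.M →* ℂˣ}
    (hfd : FiniteDimensional ℂ (t.restrict ρ).Coinvariants)
    (h2 : Module.finrank ℂ (t.restrict ρ).Coinvariants = 2)
    (ℓ : Submodule ℂ (t.restrict ρ).Coinvariants) (hℓ1 : Module.finrank ℂ ↥ℓ = 1)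
    (hℓ : ∀ (m : ↥t.M), ∀ x ∈ ℓ, ρ.normalizedJacquet t m x = ((θ₁ m : ℂˣ) : ℂ) • x)
    (hq : ∀ (m : ↥t.M) (x : (t.restrict ρ).Coinvariants), ρ.normalizedJacquet t m x - ((θ₂ m : ℂˣ) : ℂ) • x ∈ ℓ)
    (hNlim : IsLimitOfCompactOpen t.N) (hδ : ∀ (n : G) (hn : n ∈ t.N), deltaChar t.P ⟨n, t.N_le hn⟩ = 1)
    {W : Type} {instW₁ : AddCommGroup W} {instW₂ : Module ℂ W} {σ : Representation ℂ ↥t.M W}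
    (eρ : ρ.Equiv (Representation.normalizedInd t σ))
    (hρ : ρ.IsSmooth) (N : Subrepresentation ρ) (hNb : N ≠ ⊥) (hNt : N ≠ ⊤)
    (hlen : ∀ N₁ N₂ : Subrepresentation ρ, ¬ (⊥ < N₁ ∧ N₁ < N₂ ∧ N₂ < ⊤)) (hne : θ₁ ≠ θ₂)
    {V' : Type} {instV'₁ : AddCommGroup V'} {instV'₂ : Module ℂ V'} {ρ' : Representation ℂ G V'}
    (hemb : ∀ c : IrrClass G, c.IsConstituentOf ρ → ∃ r : SmoothIrrep G, IrrClass.mk r = c ∧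
      ((∃ f : r.ρ.IntertwiningMap ρ, Function.Injective f) ∨ (∃ f : r.ρ.IntertwiningMap ρ', Function.Injective f)))
    {W' : Type} {instW'₁ : AddCommGroup W'} {instW'₂ : Module ℂ W'} {σ' : Representation ℂ ↥t.M W'}
    (eρ' : ρ'.Equiv (Representation.normalizedInd t σ')) :
    ∃ πs πn : IrrClass G, πs ≠ πn ∧
      (∀ c : IrrClass G, c.IsConstituentOf ρ ↔ (c = πn ∨ c = πs)) ∧
      (∃ r : SmoothIrrep G, IrrClass.mk r = πs ∧
        Nonempty ((r.ρ.normalizedJacquet t).Equiv ((Representation.trivial ℂ ↥t.M ℂ).twist θ₂))) ∧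
      (∃ r : SmoothIrrep G, IrrClass.mk r = πn ∧
        Nonempty ((r.ρ.normalizedJacquet t).Equiv ((Representation.trivial ℂ ↥t.M ℂ).twist θ₁))) := by
  have hN : N.toRepresentation.IsIrreducible := isIrreducible_toRepresentation_of_forall_not_lt_lt hlen hNb hNt
  have hQ : N.quotientRep.IsIrreducible := isIrreducible_quotientRep_of_forall_not_lt_lt hlen hNb hNt
  let rs : SmoothIrrep G := SmoothIrrep.mk ↥N.toSubmodule N.toRepresentation hN (hρ.toRepresentation N)
  let rn : SmoothIrrep G := SmoothIrrep.mk (_ ⧸ N.toSubmodule) N.quotientRep hQ (hρ.quotientRep N)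
  have hcons : ∀ c : IrrClass G, c.IsConstituentOf ρ ↔ (c = IrrClass.mk rn ∨ c = IrrClass.mk rs) :=
    fun c => isConstituentOf_iff_of_isIrreducible hρ N hN hQ c
  -- exactness of `r` along `0 → N → ρ → ρ⁄N → 0`
  obtain ⟨hJinj, hJex, hJsurj⟩ := Representation.jacquet_exact_holds (k := ℂ) t hNlim (hρ.toRepresentation N) hρ
    (hρ.quotientRep N) (Subrepresentation.subtypeIntertwiningMap N) N.mkQ (Subrepresentation.subtypeIntertwiningMap_injective N)
    (exact_subtype_mkQ N) N.mkQ_surjective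
  -- `r(ρ|_N) ≠ 0`: Frobenius on `ρ|_N ↪ ρ ≅ i(σ)`
  haveI : Nontrivial ↥N.toSubmodule := Representation.IsIrreducible.nontrivial N.toRepresentation
  haveI hJN : Nontrivial (t.restrict N.toRepresentation).Coinvariants :=
    nontrivial_coinvariants_of_injective_normalizedInd t hδ σ N.toRepresentation (hρ.toRepresentation N)
      (eρ.toIntertwiningMap.comp (Subrepresentation.subtypeIntertwiningMap N))
      (eρ.toLinearEquiv.injective.comp (Subrepresentation.subtypeIntertwiningMap_injective N))
  -- `r(ρ⁄N) ≠ 0`: `⟦ρ⁄N⟧` is a constituent, so a representative embeds into `ρ ≅ i(σ)` or `ρ' ≅ i(σ')`; Frobenius there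
  haveI hJQ : Nontrivial (t.restrict N.quotientRep).Coinvariants := by
    obtain ⟨r, hr, hfr⟩ := hemb (IrrClass.mk rn) ((hcons _).2 (Or.inl rfl))
    obtain ⟨e⟩ := (IrrClass.mk_eq_mk_iff r rn).1 hr
    haveI : Nontrivial r.V := Representation.IsIrreducible.nontrivial r.ρ
    haveI : Nontrivial (t.restrict r.ρ).Coinvariants := by
      rcases hfr with ⟨f, hf⟩ | ⟨f, hf⟩
      · exact nontrivial_coinvariants_of_injective_normalizedInd t hδ σ r.ρ r.isSmooth (eρ.toIntertwiningMap.comp f)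
          (eρ.toLinearEquiv.injective.comp hf)
      · exact nontrivial_coinvariants_of_injective_normalizedInd t hδ σ' r.ρ r.isSmooth (eρ'.toIntertwiningMap.comp f)
          (eρ'.toLinearEquiv.injective.comp hf)
    exact (jacquetMap_equiv_injective t e).nontrivial
  -- the two cases
  haveI := hfd
  obtain ⟨hfdN, hfdQ, h1N, h1Q, hcases⟩ := Representation.normalizedJacquet_sub_quot_cases_of_line t
    (Subrepresentation.subtypeIntertwiningMap N) N.mkQ hJinj hJex hJsurj h2 ℓ hℓ1 hℓ hq
  haveI := hfdN
  haveI := hfdQ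
  have hsep : ∀ {ψ ψ' : ↥t.M →* ℂˣ}, ψ ≠ ψ' →
      (∀ (m : ↥t.M) (x : (t.restrict N.toRepresentation).Coinvariants), N.toRepresentation.normalizedJacquet t m x = ((ψ m : ℂˣ) : ℂ) • x) →
      (∀ (m : ↥t.M) (z : (t.restrict N.quotientRep).Coinvariants), N.quotientRep.normalizedJacquet t m z = ((ψ' m : ℂˣ) : ℂ) • z) →
      IrrClass.mk rs ≠ IrrClass.mk rn := by
    intro ψ ψ' hψ hactN hactQ heq
    obtain ⟨e⟩ := (IrrClass.mk_eq_mk_iff _ _).1 heq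
    have hexpQ : N.quotientRep.HasJacquetExponent t ψ :=
      (Representation.hasJacquetExponent_of_forall_eq_smul t hactN).map_of_injective t e.toIntertwiningMap
        (jacquetMap_equiv_injective t e)
    exact hψ (Representation.HasJacquetExponent.eq_of_forall_eq_smul t hactQ hexpQ)
  rcases hcases with ⟨hactN, hactQ⟩ | ⟨hactN, hactQ⟩
  · refine ⟨IrrClass.mk rn, IrrClass.mk rs, (hsep hne hactN hactQ).symm, fun c => (hcons c).trans Or.comm,
      ⟨rn, rfl, Representation.nonempty_normalizedJacquet_equiv_twist_of_finrank_eq_one t h1Q hactQ⟩,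
      ⟨rs, rfl, Representation.nonempty_normalizedJacquet_equiv_twist_of_finrank_eq_one t h1N hactN⟩⟩
  · refine ⟨IrrClass.mk rs, IrrClass.mk rn, hsep hne.symm hactN hactQ, hcons,
      ⟨rs, rfl, Representation.nonempty_normalizedJacquet_equiv_twist_of_finrank_eq_one t h1N hactN⟩,
      ⟨rn, rfl, Representation.nonempty_normalizedJacquet_equiv_twist_of_finrank_eq_one t h1Q hactQ⟩⟩

end IrrClass

end Literature.NumberTheory.Automorphic

end
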